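import Literature.NumberTheory.Automorphic.Liu2021.ThetaLiftFromLineCentralCharacter
import HarnessLib

-- As in the lineage (★ `ThetaLiftFromLineCharacters`, ★ `ThetaLiftFromLineCentralCharacter`): statements over the theta-kernel datum
-- elaborate to very large types; elaborate sequentially.
set_option Elab.async false

/-!
# Crux `HLiu418`, lines LD1 ∕ LD2 — THE TRANSPORT KIT: the ★ theta-road lemmas of `Liu2021.ThetaLiftFromLineCharacters` §3–§6 and
# `Liu2021.ThetaLiftFromLineCentralCharacter` §3–§4 for an ABSTRACT adelic transport `ιA : U(H)(𝔸_{L⁺}) →* U(diag dV)(𝔸_{L⁺})`,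
# and the supply of its two hypotheses under the curve letters' SCALED frame `ᵗ(c̄ g)·(t • H)·g = diag dV`

Cell hodgecm-mathlib (D-0151), FLOOR 0; crux item `HLiu418` = stmt-HodgeConjecture-24832 (route `HCCMUnconditional`); half-A lines LD1
(`stub_S1_facts` = #73) and LD2 (`stub_S1b_facts` = #74) of socket 27458 `Cruxes/HLiu418/Lines/F0_AlbCm.lean`.  Seat LD1-p01 (g0), organ (I)
`stub_thetaCharRigid` of the LD1 skeleton (LD1-plan (g0) v1, 2026-09-02).  THEOREMS ONLY (no `def`, no instance, no notation, no named fact,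
no `sorry`); `--supports stmt-HodgeConjecture-24832`.  HC_CM is proved only modulo the 7 printed citations (2 remaining: hLiu418 =
stmt-HodgeConjecture-24832, h413 = stmt-HodgeConjecture-24833) until rung 0 closes; this file discharges nothing printed — kernel glue.

WHY.  The ★ theta-road files (typer T5a∕T5b, `N = 3` line) read the theta lift of the line `⟨a⟩` on `U(H)(𝔸_{L⁺})` along the LITERAL transport
★ `cmAdelicFrameTransport L N H dV g hg` of an UNSCALED frame `hg : ᵗ(c̄ g)·H·g = diag dV`.  The rank-2 letters #73∕#74 (★
`Rogawski1990.curveThetaCohFinComponentUnique_hol`, `…HodgeTypeNecessity_hol`) and hence every organ of the LD1∕LD2 skeletons carry instead an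
ABSTRACT homomorphism `ιA` pinned by its matrix formula `↑(ιA k) = g_𝔸⁻¹ · k · g_𝔸` under the SCALED frame `formCongr c g (t • H) = diag dV` — for which
★ `eq_cmAdelicFrameTransport_of_coe` is unavailable (the unscaled relation holds for `t • H`, whose datum ★ `adelicGroupData_cm_smul` equals that of `H`
only propositionally, while ★ `MeetsThetaLiftFromLine L N H …` takes `H` explicitly).  This file re-reads the ★ lemmas for ANY `ιA` that is
CONTINUOUS and carries RATIONAL POINTS TO RATIONAL POINTS (the only two properties of `cmAdelicFrameTransport` the ★ proofs use — the proofs below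
are those proofs with `cmAdelicFrameTransport ↦ ιA`), plus, for the centre, the property `ιA (u·1_H) = u·1_{diag dV}` (★ `frameTransport_adelicCenter`
derives it from the matrix formula); the sequel ★-to-be `Theorems/F0LD1ThetaTransportKitCentre` SUPPLIES continuity and rationality from the matrix formula under the
scaled frame (through `U(H)(𝔸) = U(t • H)(𝔸)`, ★ `adelicUnitaryGroup_smul`, and the unscaled frame transport ★ `cmFrameEquiv` of `t • H`).

* §1 (abstract `ιA`, rank-generic `N`): `lineThetaLiftFun_transport_mul_left`, `continuous_lineThetaLiftFun_transport`, `toQuotFun_lineThetaLift_mk`,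
  `continuous_toQuotFun_lineThetaLift`, `norm_toQuotFun_lineThetaLift_le`, `memLp_toQuotFun_lineThetaLift`, `toQuotFun_lineThetaLift_add ∕ _smul`,
  `exists_charCM_of_apply_toLp_lineThetaLift_ne_zero` (= ★ §3–§4).
* §2 (abstract `ιA`): `lineThetaLiftFun_transport_mul_right`, `rightRegular_toLp_lineThetaLift` (`R(k) [Θ̃_Φ(f) ∘ ιA] = [Θ̃_{ω(ιA k,1)Φ}(f) ∘ ιA]`),
  `lineThetaLiftFun_pairRep_one_charCM` (at any point of `U(diag dV)(𝔸)`), `toLp_lineThetaLift_pairRep_one_charCM` (= ★ §6).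
* (sequel `F0LD1ThetaTransportKitCentre`: §3 the centre — `rightRegular_adelicCenter_toLp_lineThetaLift_charCM`, `centralCharacter_eq_charCM`; §4 the SUPPLY of
  continuity ∧ rationality from the matrix formula under the scaled frame — `continuous_of_coe_eq`, `mem_range_toAdelic_of_coe_eq`, `transportHyp_of_coe_eq`.)

References: [Liu2021] Y. Liu, Camb. J. Math. 9 (2021), proof of Prop. 4.13 Case 1 (p. 48); App. D §D.1.  [GelbartRogawski1991] S. Gelbart, J. Rogawski,
Invent. Math. 105 (1991), §3.1 Prop. 3.1.1 p. 455, §3.2 p. 457.  [FleigEtAl2018] P. Fleig et al., CUP (2018), §12.3 Def. 12.5 (12.37) p. 296.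
[BorelJacquet1979] A. Borel, H. Jacquet, PSPM 33.1 (1979), §4.2, §4.6.  [DeitmarEchterhoff2014] A. Deitmar, S. Echterhoff (2014), Prop. 3.5.2, Thm. 7.3.2.
[PlatonovRapinchuk1994] V. Platonov, A. Rapinchuk (1994), §2.3.  [Mok2014] C. P. Mok, Mem. AMS 235 (2015), §1 Notation p. 5.
-/

set_option autoImplicit false
-- the mandated namespace has the single-problem summit's repeated segment (`HodgeConjecture.HodgeConjecture`)
set_option linter.dupNamespace false

noncomputable section

open NumberField MeasureTheory IsDedekindDomain
open scoped Matrix Kronecker ComplexOrder ENNReal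
open Literature.NumberTheory.Automorphic Literature.NumberTheory.Automorphic.UnitaryGroup
open Literature.NumberTheory.Automorphic.UnitaryGroup.CotangentForms
open Literature.NumberTheory.Automorphic.IdeleClassGroup
open Literature.NumberTheory.Automorphic.Liu2021
open Literature.NumberTheory.Automorphic.Liu2021.Def411WeilCarriers
open Literature.NumberTheory.Automorphic.Liu2021.Def411WeilCarriersDoubling
open Literature.NumberTheory.GelbartRogawski1991 Literature.NumberTheory.GelbartRogawski1991.UnitaryDualPair
open Literature.NumberTheory.Weil1964
open Literature.RepresentationTheory.Liu2021
open Literature.RepresentationTheory.CompactGroups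
open Literature.RepresentationTheory.HeisenbergGroup

namespace Summit.HodgeConjecture.HodgeConjecture.Cruxes.HLiu418.F0LD1ThetaTransportKit

/-! ## §1 The theta lift of the line read on `U(H)(𝔸_{L⁺})` along an ABSTRACT transport, and character detection -/

section Lift

variable (L : Type) [Field L] [NumberField L] [IsCMField L] (N : ℕ) (H : Matrix (Fin N) (Fin N) L)
  {n' : ℕ} (e₁ : Fin N × Fin 1 ≃ Fin n') (dV : Fin N → L) (hdV : ∀ i, IsCMField.complexConj L (dV i) = dV i)
  (hdV0 : ∀ i, dV i ≠ 0)
  (ιA : (adelicGroupData (↥(maximalRealSubfield L)) L (IsCMField.complexConj L) N H).Adelic →* ↥(UnitaryGroup.adelic (↥(maximalRealSubfield L)) L (IsCMField.complexConj L) N (Matrix.diagonal dV)))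
  (hιA : Continuous ιA ∧ ∀ ⦃γ : (adelicGroupData (↥(maximalRealSubfield L)) L (IsCMField.complexConj L) N H).Adelic⦄,
    γ ∈ (UnitaryGroup.toAdelic (↥(maximalRealSubfield L)) L (IsCMField.complexConj L) N H).range →
      ιA γ ∈ (UnitaryGroup.toAdelic (↥(maximalRealSubfield L)) L (IsCMField.complexConj L) N (Matrix.diagonal dV)).range)
  (μ : Literature.NumberTheory.Automorphic.IdeleClassGroup L →ₜ* Circle) (hμ : IsConjugateSymplectic L μ) (a : (↥(maximalRealSubfield L))ˣ)
  (hρ : HasThetaMajorants fun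
      (p : ↥(UnitaryGroup.adelic (↥(maximalRealSubfield L)) L (IsCMField.complexConj L) N (Matrix.diagonal dV)) × ↥(UnitaryGroup.adelic (↥(maximalRealSubfield L)) L (IsCMField.complexConj L) 1 (JW (↥(maximalRealSubfield L)) L a))) (Φ : piSchwartzBruhat (↥(maximalRealSubfield L)) (Fin n')) =>
        pairRep (↥(maximalRealSubfield L)) L (IsCMField.complexConj L) N 1 e₁ (Matrix.diagonal dV) (JW (↥(maximalRealSubfield L)) L a)
          (chiSplittingLine L e₁ dV hdV hdV0 (toHeckeCharacter L μ) (isUnitary_toHeckeCharacter L μ)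
            ((isOscillatorChar_toHeckeCharacter_iff μ).mpr hμ) (TW (↥(maximalRealSubfield L)) a)
            (isUnit_det_TW (↥(maximalRealSubfield L)) a) (JW (↥(maximalRealSubfield L)) L a) (JW_eq (↥(maximalRealSubfield L)) L a))
          p Φ)
  [CompactSpace (↥(UnitaryGroup.adelic (↥(maximalRealSubfield L)) L (IsCMField.complexConj L) N (Matrix.diagonal dV)) ⧸ (UnitaryGroup.toAdelic (↥(maximalRealSubfield L)) L (IsCMField.complexConj L) N (Matrix.diagonal dV)).range)] [MeasurableSpace (↥(UnitaryGroup.adelic (↥(maximalRealSubfield L)) L (IsCMField.complexConj L) 1 (JW (↥(maximalRealSubfield L)) L a)) ⧸ (UnitaryGroup.toAdelic (↥(maximalRealSubfield L)) L (IsCMField.complexConj L) 1 (JW (↥(maximalRealSubfield L)) L a)).range)] (μW : Measure (↥(UnitaryGroup.adelic (↥(maximalRealSubfield L)) L (IsCMField.complexConj L) 1 (JW (↥(maximalRealSubfield L)) L a)) ⧸ (UnitaryGroup.toAdelic (↥(maximalRealSubfield L)) L (IsCMField.complexConj L) 1 (JW (↥(maximalRealSubfield L)) L a)).range))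
  (Φ : piSchwartzBruhat (↥(maximalRealSubfield L)) (Fin n')) (f : C((↥(UnitaryGroup.adelic (↥(maximalRealSubfield L)) L (IsCMField.complexConj L) 1 (JW (↥(maximalRealSubfield L)) L a)) ⧸ (UnitaryGroup.toAdelic (↥(maximalRealSubfield L)) L (IsCMField.complexConj L) 1 (JW (↥(maximalRealSubfield L)) L a)).range), ℂ))

include hιA

/-- **Left invariance**: `x ↦ Θ̃_Φ(f)(ιA x)` is invariant under `A_G · U(H)(L⁺) = U(H)(L⁺)` (the transport carries rational points to
rational points, ★ `cmAdelicFrameTransport_mem_range_toAdelic`; the lift is left-`U(diag dV)(L⁺)`-invariant, ★ `thetaLiftFun_mul_left`).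
[cite: BorelJacquet1979, §4.2] [cite: FleigEtAl2018, §12.3 Def. 12.5 (12.37) p. 296] -/
theorem lineThetaLiftFun_transport_mul_left {γ : (adelicGroupData (↥(maximalRealSubfield L)) L (IsCMField.complexConj L) N H).Adelic} (hγ : γ ∈ (adelicGroupData (↥(maximalRealSubfield L)) L (IsCMField.complexConj L) N H).quotientSubgroup) (x : (adelicGroupData (↥(maximalRealSubfield L)) L (IsCMField.complexConj L) N H).Adelic) :
    (lineThetaKernelDatum L N e₁ dV hdV hdV0 μ hμ a hρ).thetaLiftFun μW Φ f (ιA (γ * x)) = (lineThetaKernelDatum L N e₁ dV hdV hdV0 μ hμ a hρ).thetaLiftFun μW Φ f (ιA x) := by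
  have hγ' : γ ∈ (UnitaryGroup.toAdelic (↥(maximalRealSubfield L)) L (IsCMField.complexConj L) N H).range := by
    have h' : γ ∈ (⊥ : Subgroup (adelicGroupData (↥(maximalRealSubfield L)) L (IsCMField.complexConj L) N H).Adelic) ⊔ (UnitaryGroup.toAdelic (↥(maximalRealSubfield L)) L (IsCMField.complexConj L) N H).range := hγ
    rwa [bot_sup_eq] at h'
  rw [map_mul]
  exact (lineThetaKernelDatum L N e₁ dV hdV hdV0 μ hμ a hρ).thetaLiftFun_mul_left μW Φ f (hιA.2 hγ') _

/-- **Continuity on the group**: `x ↦ Θ̃_Φ(f)(ιA x) = Θ_Φ(f)([(ιA x)⁻¹])` is continuous (`Θ_Φ(f) ∈ C([U(diag dV)], ℂ)`, the transport is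
continuous, ★ `continuous_cmAdelicFrameTransport`). [cite: FleigEtAl2018, §12.3 Def. 12.5 (12.37) p. 296] -/
theorem continuous_lineThetaLiftFun_transport : Continuous fun x => (lineThetaKernelDatum L N e₁ dV hdV hdV0 μ hμ a hρ).thetaLiftFun μW Φ f (ιA x) := by
  have h1 : Continuous fun x : (adelicGroupData (↥(maximalRealSubfield L)) L (IsCMField.complexConj L) N H).Adelic => (QuotientGroup.mk ((ιA x)⁻¹) : ↥(UnitaryGroup.adelic (↥(maximalRealSubfield L)) L (IsCMField.complexConj L) N (Matrix.diagonal dV)) ⧸ (UnitaryGroup.toAdelic (↥(maximalRealSubfield L)) L (IsCMField.complexConj L) N (Matrix.diagonal dV)).range) :=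
    continuous_quotient_mk'.comp (hιA.1).inv
  exact ((lineThetaKernelDatum L N e₁ dV hdV hdV0 μ hμ a hρ).thetaLift μW Φ f).continuous.comp h1

/-- **The descended lift in closed form**: `toQuotFun [x] = Θ_Φ(f)([ιA x])` (`toQuotFun` evaluates at `x⁻¹`, and `Θ̃(x⁻¹) = Θ([x])`).
[cite: BorelJacquet1979, §4.2] [cite: FleigEtAl2018, §12.3 Def. 12.5 (12.37) p. 296] -/
theorem toQuotFun_lineThetaLift_mk (x : (adelicGroupData (↥(maximalRealSubfield L)) L (IsCMField.complexConj L) N H).Adelic) :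
    toQuotFun (adelicGroupData (↥(maximalRealSubfield L)) L (IsCMField.complexConj L) N H) (fun y => (lineThetaKernelDatum L N e₁ dV hdV hdV0 μ hμ a hρ).thetaLiftFun μW Φ f (ιA y)) ((adelicGroupData (↥(maximalRealSubfield L)) L (IsCMField.complexConj L) N H).toAutomorphicQuotient x) =
      (lineThetaKernelDatum L N e₁ dV hdV hdV0 μ hμ a hρ).thetaLift μW Φ f (QuotientGroup.mk (ιA x)) := by
  have hΦ : ∀ γ ∈ (adelicGroupData (↥(maximalRealSubfield L)) L (IsCMField.complexConj L) N H).quotientSubgroup, ∀ y,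
      (fun y => (lineThetaKernelDatum L N e₁ dV hdV hdV0 μ hμ a hρ).thetaLiftFun μW Φ f (ιA y)) (γ * y) =
        (fun y => (lineThetaKernelDatum L N e₁ dV hdV hdV0 μ hμ a hρ).thetaLiftFun μW Φ f (ιA y)) y :=
    fun γ hγ y => lineThetaLiftFun_transport_mul_left L N H e₁ dV hdV hdV0 ιA hιA μ hμ a hρ μW Φ f hγ y
  refine (toQuotFun_mk hΦ x).trans ?_
  show (lineThetaKernelDatum L N e₁ dV hdV hdV0 μ hμ a hρ).thetaLift μW Φ f (QuotientGroup.mk (ιA x⁻¹)⁻¹) = _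
  congr 1
  rw [map_inv, inv_inv]

/-- **Continuity on the quotient**: the descended lift `toQuotFun … ∈ C([U(H)], ℂ)` (the quotient map is a quotient map).
[cite: BorelJacquet1979, §4.2] -/
theorem continuous_toQuotFun_lineThetaLift : Continuous (toQuotFun (adelicGroupData (↥(maximalRealSubfield L)) L (IsCMField.complexConj L) N H) fun y => (lineThetaKernelDatum L N e₁ dV hdV hdV0 μ hμ a hρ).thetaLiftFun μW Φ f (ιA y)) := by
  have hq : Topology.IsQuotientMap (adelicGroupData (↥(maximalRealSubfield L)) L (IsCMField.complexConj L) N H).toAutomorphicQuotient :=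
    QuotientGroup.isQuotientMap_mk _
  rw [hq.continuous_iff]
  have he : (toQuotFun (adelicGroupData (↥(maximalRealSubfield L)) L (IsCMField.complexConj L) N H) fun y => (lineThetaKernelDatum L N e₁ dV hdV hdV0 μ hμ a hρ).thetaLiftFun μW Φ f (ιA y)) ∘ (adelicGroupData (↥(maximalRealSubfield L)) L (IsCMField.complexConj L) N H).toAutomorphicQuotient =
      fun x => (lineThetaKernelDatum L N e₁ dV hdV hdV0 μ hμ a hρ).thetaLift μW Φ f (QuotientGroup.mk (ιA x)) :=
    funext (toQuotFun_lineThetaLift_mk L N H e₁ dV hdV hdV0 ιA hιA μ hμ a hρ μW Φ f)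
  rw [he]
  exact ((lineThetaKernelDatum L N e₁ dV hdV hdV0 μ hμ a hρ).thetaLift μW Φ f).continuous.comp (continuous_quotient_mk'.comp (hιA.1))

/-- **Sup-norm bound**: `|toQuotFun … q| ≤ ‖Θ_Φ(f)‖_∞` for every `q ∈ [U(H)]` (the values are values of `Θ_Φ(f)`).
[cite: FleigEtAl2018, §12.3 Def. 12.5 (12.37) p. 296] -/
theorem norm_toQuotFun_lineThetaLift_le (q : (adelicGroupData (↥(maximalRealSubfield L)) L (IsCMField.complexConj L) N H).automorphicQuotient) :
    ‖toQuotFun (adelicGroupData (↥(maximalRealSubfield L)) L (IsCMField.complexConj L) N H) (fun y => (lineThetaKernelDatum L N e₁ dV hdV hdV0 μ hμ a hρ).thetaLiftFun μW Φ f (ιA y)) q‖ ≤ ‖(lineThetaKernelDatum L N e₁ dV hdV hdV0 μ hμ a hρ).thetaLift μW Φ f‖ := by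
  obtain ⟨x, rfl⟩ := QuotientGroup.mk_surjective q
  rw [show (QuotientGroup.mk x : (adelicGroupData (↥(maximalRealSubfield L)) L (IsCMField.complexConj L) N H).automorphicQuotient) = (adelicGroupData (↥(maximalRealSubfield L)) L (IsCMField.complexConj L) N H).toAutomorphicQuotient x from rfl,
    toQuotFun_lineThetaLift_mk L N H e₁ dV hdV hdV0 ιA hιA μ hμ a hρ μW Φ f x]
  exact ((lineThetaKernelDatum L N e₁ dV hdV hdV0 μ hμ a hρ).thetaLift μW Φ f).norm_coe_le_norm _

/-- **The descended lift is in every `L^p`** of a finite measure on the compact quotient `[U(H)]` — in particular the `MemLp … 2 μA`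
witness `hθ` of the seam `MeetsThetaLiftFromLine` holds for EVERY weight `f`. [cite: BorelJacquet1979, §4.6] -/
theorem memLp_toQuotFun_lineThetaLift [CompactSpace (adelicGroupData (↥(maximalRealSubfield L)) L (IsCMField.complexConj L) N H).automorphicQuotient] (ν : Measure (adelicGroupData (↥(maximalRealSubfield L)) L (IsCMField.complexConj L) N H).automorphicQuotient) [IsFiniteMeasure ν]
    (p : ℝ≥0∞) : MemLp (toQuotFun (adelicGroupData (↥(maximalRealSubfield L)) L (IsCMField.complexConj L) N H) fun y => (lineThetaKernelDatum L N e₁ dV hdV hdV0 μ hμ a hρ).thetaLiftFun μW Φ f (ιA y)) p ν :=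
  (continuous_toQuotFun_lineThetaLift L N H e₁ dV hdV hdV0 ιA hιA μ hμ a hρ μW Φ f).memLp_of_hasCompactSupport (HasCompactSupport.of_compactSpace _)

variable [BorelSpace (↥(UnitaryGroup.adelic (↥(maximalRealSubfield L)) L (IsCMField.complexConj L) 1 (JW (↥(maximalRealSubfield L)) L a)) ⧸ (UnitaryGroup.toAdelic (↥(maximalRealSubfield L)) L (IsCMField.complexConj L) 1 (JW (↥(maximalRealSubfield L)) L a)).range)] [IsFiniteMeasure μW]

/-- **Additivity in the weight** (★ `thetaLift_add`). [cite: FleigEtAl2018, §12.3 Def. 12.5 (12.37) p. 296] -/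
theorem toQuotFun_lineThetaLift_add (f₁ f₂ : C((↥(UnitaryGroup.adelic (↥(maximalRealSubfield L)) L (IsCMField.complexConj L) 1 (JW (↥(maximalRealSubfield L)) L a)) ⧸ (UnitaryGroup.toAdelic (↥(maximalRealSubfield L)) L (IsCMField.complexConj L) 1 (JW (↥(maximalRealSubfield L)) L a)).range), ℂ)) :
    (toQuotFun (adelicGroupData (↥(maximalRealSubfield L)) L (IsCMField.complexConj L) N H) fun y => (lineThetaKernelDatum L N e₁ dV hdV hdV0 μ hμ a hρ).thetaLiftFun μW Φ (f₁ + f₂) (ιA y)) =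
      (toQuotFun (adelicGroupData (↥(maximalRealSubfield L)) L (IsCMField.complexConj L) N H) fun y => (lineThetaKernelDatum L N e₁ dV hdV hdV0 μ hμ a hρ).thetaLiftFun μW Φ f₁ (ιA y)) + toQuotFun (adelicGroupData (↥(maximalRealSubfield L)) L (IsCMField.complexConj L) N H) fun y => (lineThetaKernelDatum L N e₁ dV hdV hdV0 μ hμ a hρ).thetaLiftFun μW Φ f₂ (ιA y) := by
  haveI := compactSpace_quotient_range_toAdelic_JW L a
  funext q
  obtain ⟨x, rfl⟩ := QuotientGroup.mk_surjective q
  simp only [Pi.add_apply]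
  rw [show (QuotientGroup.mk x : (adelicGroupData (↥(maximalRealSubfield L)) L (IsCMField.complexConj L) N H).automorphicQuotient) = (adelicGroupData (↥(maximalRealSubfield L)) L (IsCMField.complexConj L) N H).toAutomorphicQuotient x from rfl,
    toQuotFun_lineThetaLift_mk L N H e₁ dV hdV hdV0 ιA hιA μ hμ a hρ μW Φ (f₁ + f₂) x, toQuotFun_lineThetaLift_mk L N H e₁ dV hdV hdV0 ιA hιA μ hμ a hρ μW Φ f₁ x, toQuotFun_lineThetaLift_mk L N H e₁ dV hdV hdV0 ιA hιA μ hμ a hρ μW Φ f₂ x,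
    (lineThetaKernelDatum L N e₁ dV hdV hdV0 μ hμ a hρ).thetaLift_add μW Φ f₁ f₂, ContinuousMap.add_apply]

omit [BorelSpace (↥(UnitaryGroup.adelic (↥(maximalRealSubfield L)) L (IsCMField.complexConj L) 1 (JW (↥(maximalRealSubfield L)) L a)) ⧸ (UnitaryGroup.toAdelic (↥(maximalRealSubfield L)) L (IsCMField.complexConj L) 1 (JW (↥(maximalRealSubfield L)) L a)).range)] [IsFiniteMeasure μW] in
/-- **Homogeneity in the weight** (★ `thetaLift_smul`). [cite: FleigEtAl2018, §12.3 Def. 12.5 (12.37) p. 296] -/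
theorem toQuotFun_lineThetaLift_smul (r : ℂ) (f₁ : C((↥(UnitaryGroup.adelic (↥(maximalRealSubfield L)) L (IsCMField.complexConj L) 1 (JW (↥(maximalRealSubfield L)) L a)) ⧸ (UnitaryGroup.toAdelic (↥(maximalRealSubfield L)) L (IsCMField.complexConj L) 1 (JW (↥(maximalRealSubfield L)) L a)).range), ℂ)) :
    (toQuotFun (adelicGroupData (↥(maximalRealSubfield L)) L (IsCMField.complexConj L) N H) fun y => (lineThetaKernelDatum L N e₁ dV hdV hdV0 μ hμ a hρ).thetaLiftFun μW Φ (r • f₁) (ιA y)) =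
      r • toQuotFun (adelicGroupData (↥(maximalRealSubfield L)) L (IsCMField.complexConj L) N H) fun y => (lineThetaKernelDatum L N e₁ dV hdV hdV0 μ hμ a hρ).thetaLiftFun μW Φ f₁ (ιA y) := by
  funext q
  obtain ⟨x, rfl⟩ := QuotientGroup.mk_surjective q
  simp only [Pi.smul_apply]
  rw [show (QuotientGroup.mk x : (adelicGroupData (↥(maximalRealSubfield L)) L (IsCMField.complexConj L) N H).automorphicQuotient) = (adelicGroupData (↥(maximalRealSubfield L)) L (IsCMField.complexConj L) N H).toAutomorphicQuotient x from rfl,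
    toQuotFun_lineThetaLift_mk L N H e₁ dV hdV hdV0 ιA hιA μ hμ a hρ μW Φ (r • f₁) x, toQuotFun_lineThetaLift_mk L N H e₁ dV hdV hdV0 ιA hιA μ hμ a hρ μW Φ f₁ x, (lineThetaKernelDatum L N e₁ dV hdV hdV0 μ hμ a hρ).thetaLift_smul μW Φ r f₁,
    ContinuousMap.smul_apply]
/-- **If a continuous linear map `T` out of `L²([U(H)], ν)` does not kill the class of `Θ̃_Φ(f) ∘ ιA`, it does not kill the class of
`Θ̃_Φ(χ) ∘ ιA` for some continuous unitary CHARACTER `χ` of the compact abelian group `[U(⟨a⟩)]`.**  `f ↦ T [Θ̃_Φ(f) ∘ ιA]` is continuous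
and linear on `C([U(⟨a⟩)], ℂ)` (§3, ★ `norm_thetaLift_le`, Mathlib `ContinuousMap.toLp`), and the characters span a dense subspace (★
`CompactGroups.mem_closure_span_range_charCM`: Pontryagin–van Kampen + Stone–Weierstrass); a continuous linear map has closed kernel.
[cite: DeitmarEchterhoff2014, Prop. 3.5.2] [cite: GelbartRogawski1991, §3.2 p. 457] -/
theorem exists_charCM_of_apply_toLp_lineThetaLift_ne_zero [CompactSpace (adelicGroupData (↥(maximalRealSubfield L)) L (IsCMField.complexConj L) N H).automorphicQuotient]
    (ν : Measure (adelicGroupData (↥(maximalRealSubfield L)) L (IsCMField.complexConj L) N H).automorphicQuotient) [IsFiniteMeasure ν] {X : Type*} [NormedAddCommGroup X] [NormedSpace ℂ X]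
    (T : Lp ℂ 2 ν →L[ℂ] X)
    (hT : T (MemLp.toLp _ (memLp_toQuotFun_lineThetaLift L N H e₁ dV hdV hdV0 ιA hιA μ hμ a hρ μW Φ f ν 2)) ≠ 0) :
    haveI := normal_range_toAdelic_JW L a
    ∃ χ : PontryaginDual (↥(UnitaryGroup.adelic (↥(maximalRealSubfield L)) L (IsCMField.complexConj L) 1 (JW (↥(maximalRealSubfield L)) L a)) ⧸ (UnitaryGroup.toAdelic (↥(maximalRealSubfield L)) L (IsCMField.complexConj L) 1 (JW (↥(maximalRealSubfield L)) L a)).range), T (MemLp.toLp _ (memLp_toQuotFun_lineThetaLift L N H e₁ dV hdV hdV0 ιA hιA μ hμ a hρ μW Φ (charCM χ) ν 2)) ≠ 0 := by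
  haveI hN := normal_range_toAdelic_JW L a
  letI : CommGroup ↥(UnitaryGroup.adelic (↥(maximalRealSubfield L)) L (IsCMField.complexConj L) 1 (JW (↥(maximalRealSubfield L)) L a)) :=
    { (inferInstance : Group ↥(UnitaryGroup.adelic (↥(maximalRealSubfield L)) L (IsCMField.complexConj L) 1 (JW (↥(maximalRealSubfield L)) L a))) with mul_comm := adelic_JW_mul_comm L a }
  haveI : CompactSpace (↥(UnitaryGroup.adelic (↥(maximalRealSubfield L)) L (IsCMField.complexConj L) 1 (JW (↥(maximalRealSubfield L)) L a)) ⧸ (UnitaryGroup.toAdelic (↥(maximalRealSubfield L)) L (IsCMField.complexConj L) 1 (JW (↥(maximalRealSubfield L)) L a)).range) := compactSpace_quotient_range_toAdelic_JW L a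
  haveI : T2Space (↥(UnitaryGroup.adelic (↥(maximalRealSubfield L)) L (IsCMField.complexConj L) 1 (JW (↥(maximalRealSubfield L)) L a)) ⧸ (UnitaryGroup.toAdelic (↥(maximalRealSubfield L)) L (IsCMField.complexConj L) 1 (JW (↥(maximalRealSubfield L)) L a)).range) := t2Space_quotient_range_toAdelic_JW L a
  -- `f' ↦ toQuotFun (Θ̃_Φ(f') ∘ ιA)` as a bounded linear map `C([U(⟨a⟩)], ℂ) → C([U(H)], ℂ)`
  let Tq : C((↥(UnitaryGroup.adelic (↥(maximalRealSubfield L)) L (IsCMField.complexConj L) 1 (JW (↥(maximalRealSubfield L)) L a)) ⧸ (UnitaryGroup.toAdelic (↥(maximalRealSubfield L)) L (IsCMField.complexConj L) 1 (JW (↥(maximalRealSubfield L)) L a)).range), ℂ) →ₗ[ℂ] C((adelicGroupData (↥(maximalRealSubfield L)) L (IsCMField.complexConj L) N H).automorphicQuotient, ℂ) :=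
    { toFun := fun f' => ⟨toQuotFun (adelicGroupData (↥(maximalRealSubfield L)) L (IsCMField.complexConj L) N H) fun y => (lineThetaKernelDatum L N e₁ dV hdV hdV0 μ hμ a hρ).thetaLiftFun μW Φ f' (ιA y), continuous_toQuotFun_lineThetaLift L N H e₁ dV hdV hdV0 ιA hιA μ hμ a hρ μW Φ f'⟩
      map_add' := fun f₁ f₂ => ContinuousMap.ext fun q => by
        simpa using congrFun (toQuotFun_lineThetaLift_add L N H e₁ dV hdV hdV0 ιA hιA μ hμ a hρ μW Φ f₁ f₂) q
      map_smul' := fun r f₁ => ContinuousMap.ext fun q => by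
        simpa using congrFun (toQuotFun_lineThetaLift_smul L N H e₁ dV hdV hdV0 ιA hιA μ hμ a hρ μW Φ r f₁) q }
  have hTq : ∀ f', ‖Tq f'‖ ≤ μW.real Set.univ * ‖(lineThetaKernelDatum L N e₁ dV hdV hdV0 μ hμ a hρ).thetaKer Φ‖ * ‖f'‖ := fun f' => by
    refine (ContinuousMap.norm_le _ (by positivity)).mpr fun q => ?_
    exact (norm_toQuotFun_lineThetaLift_le L N H e₁ dV hdV hdV0 ιA hιA μ hμ a hρ μW Φ f' q).trans ((lineThetaKernelDatum L N e₁ dV hdV hdV0 μ hμ a hρ).norm_thetaLift_le μW Φ f')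
  let S : C((↥(UnitaryGroup.adelic (↥(maximalRealSubfield L)) L (IsCMField.complexConj L) 1 (JW (↥(maximalRealSubfield L)) L a)) ⧸ (UnitaryGroup.toAdelic (↥(maximalRealSubfield L)) L (IsCMField.complexConj L) 1 (JW (↥(maximalRealSubfield L)) L a)).range), ℂ) →L[ℂ] X := T.comp ((ContinuousMap.toLp 2 ν ℂ).comp (Tq.mkContinuous _ hTq))
  have hS : ∀ f', S f' = T (MemLp.toLp _ (memLp_toQuotFun_lineThetaLift L N H e₁ dV hdV hdV0 ιA hιA μ hμ a hρ μW Φ f' ν 2)) := fun f' => by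
    show T (ContinuousMap.toLp (E := ℂ) 2 ν ℂ (Tq.mkContinuous _ hTq f')) = _
    congr 1
  by_contra hcon
  push Not at hcon
  have hle : Submodule.span ℂ (Set.range (charCM (K := (↥(UnitaryGroup.adelic (↥(maximalRealSubfield L)) L (IsCMField.complexConj L) 1 (JW (↥(maximalRealSubfield L)) L a)) ⧸ (UnitaryGroup.toAdelic (↥(maximalRealSubfield L)) L (IsCMField.complexConj L) 1 (JW (↥(maximalRealSubfield L)) L a)).range)))) ≤ LinearMap.ker (S : C((↥(UnitaryGroup.adelic (↥(maximalRealSubfield L)) L (IsCMField.complexConj L) 1 (JW (↥(maximalRealSubfield L)) L a)) ⧸ (UnitaryGroup.toAdelic (↥(maximalRealSubfield L)) L (IsCMField.complexConj L) 1 (JW (↥(maximalRealSubfield L)) L a)).range), ℂ) →ₗ[ℂ] X) :=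
    Submodule.span_le.mpr (by
      rintro _ ⟨χ, rfl⟩
      simp only [SetLike.mem_coe, LinearMap.mem_ker, ContinuousLinearMap.coe_coe, hS]
      exact hcon χ)
  have hcl : closure (Submodule.span ℂ (Set.range (charCM (K := (↥(UnitaryGroup.adelic (↥(maximalRealSubfield L)) L (IsCMField.complexConj L) 1 (JW (↥(maximalRealSubfield L)) L a)) ⧸ (UnitaryGroup.toAdelic (↥(maximalRealSubfield L)) L (IsCMField.complexConj L) 1 (JW (↥(maximalRealSubfield L)) L a)).range)))) : Set C((↥(UnitaryGroup.adelic (↥(maximalRealSubfield L)) L (IsCMField.complexConj L) 1 (JW (↥(maximalRealSubfield L)) L a)) ⧸ (UnitaryGroup.toAdelic (↥(maximalRealSubfield L)) L (IsCMField.complexConj L) 1 (JW (↥(maximalRealSubfield L)) L a)).range), ℂ)) ⊆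
      (LinearMap.ker (S : C((↥(UnitaryGroup.adelic (↥(maximalRealSubfield L)) L (IsCMField.complexConj L) 1 (JW (↥(maximalRealSubfield L)) L a)) ⧸ (UnitaryGroup.toAdelic (↥(maximalRealSubfield L)) L (IsCMField.complexConj L) 1 (JW (↥(maximalRealSubfield L)) L a)).range), ℂ) →ₗ[ℂ] X) : Set C((↥(UnitaryGroup.adelic (↥(maximalRealSubfield L)) L (IsCMField.complexConj L) 1 (JW (↥(maximalRealSubfield L)) L a)) ⧸ (UnitaryGroup.toAdelic (↥(maximalRealSubfield L)) L (IsCMField.complexConj L) 1 (JW (↥(maximalRealSubfield L)) L a)).range), ℂ)) :=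
    (ContinuousLinearMap.isClosed_ker S).closure_subset_iff.mpr hle
  have hf0 : S f = 0 := hcl (mem_closure_span_range_charCM f)
  exact hT ((hS f).symm.trans hf0)


end Lift

/-! ## §2 Equivariance of the class `[Θ̃_Φ(f) ∘ ιA]` along an ABSTRACT transport -/

section Equivariance

variable (L : Type) [Field L] [NumberField L] [IsCMField L] (N : ℕ) (H : Matrix (Fin N) (Fin N) L)
  {n' : ℕ} (e₁ : Fin N × Fin 1 ≃ Fin n') (dV : Fin N → L) (hdV : ∀ i, IsCMField.complexConj L (dV i) = dV i)
  (hdV0 : ∀ i, dV i ≠ 0)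
  (ιA : (adelicGroupData (↥(maximalRealSubfield L)) L (IsCMField.complexConj L) N H).Adelic →* ↥(UnitaryGroup.adelic (↥(maximalRealSubfield L)) L (IsCMField.complexConj L) N (Matrix.diagonal dV)))
  (hιA : Continuous ιA ∧ ∀ ⦃γ : (adelicGroupData (↥(maximalRealSubfield L)) L (IsCMField.complexConj L) N H).Adelic⦄,
    γ ∈ (UnitaryGroup.toAdelic (↥(maximalRealSubfield L)) L (IsCMField.complexConj L) N H).range →
      ιA γ ∈ (UnitaryGroup.toAdelic (↥(maximalRealSubfield L)) L (IsCMField.complexConj L) N (Matrix.diagonal dV)).range)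
  (μ : Literature.NumberTheory.Automorphic.IdeleClassGroup L →ₜ* Circle) (hμ : IsConjugateSymplectic L μ) (a : (↥(maximalRealSubfield L))ˣ)
  (hρ : HasThetaMajorants fun
      (p : ↥(UnitaryGroup.adelic (↥(maximalRealSubfield L)) L (IsCMField.complexConj L) N (Matrix.diagonal dV)) × ↥(UnitaryGroup.adelic (↥(maximalRealSubfield L)) L (IsCMField.complexConj L) 1 (JW (↥(maximalRealSubfield L)) L a))) (Φ : piSchwartzBruhat (↥(maximalRealSubfield L)) (Fin n')) =>
        pairRep (↥(maximalRealSubfield L)) L (IsCMField.complexConj L) N 1 e₁ (Matrix.diagonal dV) (JW (↥(maximalRealSubfield L)) L a)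
          (chiSplittingLine L e₁ dV hdV hdV0 (toHeckeCharacter L μ) (isUnitary_toHeckeCharacter L μ)
            ((isOscillatorChar_toHeckeCharacter_iff μ).mpr hμ) (TW (↥(maximalRealSubfield L)) a)
            (isUnit_det_TW (↥(maximalRealSubfield L)) a) (JW (↥(maximalRealSubfield L)) L a) (JW_eq (↥(maximalRealSubfield L)) L a))
          p Φ)

variable
  [CompactSpace (↥(UnitaryGroup.adelic (↥(maximalRealSubfield L)) L (IsCMField.complexConj L) N (Matrix.diagonal dV)) ⧸ (UnitaryGroup.toAdelic (↥(maximalRealSubfield L)) L (IsCMField.complexConj L) N (Matrix.diagonal dV)).range)] [MeasurableSpace (↥(UnitaryGroup.adelic (↥(maximalRealSubfield L)) L (IsCMField.complexConj L) 1 (JW (↥(maximalRealSubfield L)) L a)) ⧸ (UnitaryGroup.toAdelic (↥(maximalRealSubfield L)) L (IsCMField.complexConj L) 1 (JW (↥(maximalRealSubfield L)) L a)).range)] (μW : Measure (↥(UnitaryGroup.adelic (↥(maximalRealSubfield L)) L (IsCMField.complexConj L) 1 (JW (↥(maximalRealSubfield L)) L a)) ⧸ (UnitaryGroup.toAdelic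 (↥(maximalRealSubfield L)) L (IsCMField.complexConj L) 1 (JW (↥(maximalRealSubfield L)) L a)).range))
  (Φ : piSchwartzBruhat (↥(maximalRealSubfield L)) (Fin n')) (f : C((↥(UnitaryGroup.adelic (↥(maximalRealSubfield L)) L (IsCMField.complexConj L) 1 (JW (↥(maximalRealSubfield L)) L a)) ⧸ (UnitaryGroup.toAdelic (↥(maximalRealSubfield L)) L (IsCMField.complexConj L) 1 (JW (↥(maximalRealSubfield L)) L a)).range), ℂ))

variable [BorelSpace (↥(UnitaryGroup.adelic (↥(maximalRealSubfield L)) L (IsCMField.complexConj L) 1 (JW (↥(maximalRealSubfield L)) L a)) ⧸ (UnitaryGroup.toAdelic (↥(maximalRealSubfield L)) L (IsCMField.complexConj L) 1 (JW (↥(maximalRealSubfield L)) L a)).range)] [IsFiniteMeasure μW]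

/-- **Right translation on the group**: `Θ̃_Φ(f)(ιA (x k)) = Θ̃_{ω(ιA k, 1)Φ}(f)(ιA x)` (★ `thetaLiftFun_mul_right` along the transport).
[cite: FleigEtAl2018, §12.3 Def. 12.5 (12.37) p. 296] -/
theorem lineThetaLiftFun_transport_mul_right (x k : (adelicGroupData (↥(maximalRealSubfield L)) L (IsCMField.complexConj L) N H).Adelic) :
    (lineThetaKernelDatum L N e₁ dV hdV hdV0 μ hμ a hρ).thetaLiftFun μW Φ f (ιA (x * k)) = (lineThetaKernelDatum L N e₁ dV hdV hdV0 μ hμ a hρ).thetaLiftFun μW ((pairRep (↥(maximalRealSubfield L)) L (IsCMField.complexConj L) N 1 e₁ (Matrix.diagonal dV) (JW (↥(maximalRealSubfield L)) L a)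
          (chiSplittingLine L e₁ dV hdV hdV0 (toHeckeCharacter L μ) (isUnitary_toHeckeCharacter L μ)
            ((isOscillatorChar_toHeckeCharacter_iff μ).mpr hμ) (TW (↥(maximalRealSubfield L)) a)
            (isUnit_det_TW (↥(maximalRealSubfield L)) a) (JW (↥(maximalRealSubfield L)) L a) (JW_eq (↥(maximalRealSubfield L)) L a))) (ιA k, 1) Φ) f (ιA x) := by
  haveI := compactSpace_quotient_range_toAdelic_JW L a
  rw [map_mul]
  exact (lineThetaKernelDatum L N e₁ dV hdV hdV0 μ hμ a hρ).thetaLiftFun_mul_right μW Φ f _ _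

/-- **`U(H)(𝔸_{L⁺})`-EQUIVARIANCE OF THE CLASS**: `R(k) [Θ̃_Φ(f) ∘ ιA] = [Θ̃_{ω(ιA k, 1)Φ}(f) ∘ ιA]` in `L²([U(H)], ν)` for every `ν`
invariant under the right regular action (★ `rightRegular`) — the map `Φ ↦ [Θ̃_Φ(f) ∘ ιA]` intertwines `ω|_{U(diag dV) × 1} ∘ ιA` with the
right regular representation; restricted along ★ `finAdelicToAdelic` this is the `U(H)(𝔸_{L⁺,f})`-equivariance node B step (3) needs.
[cite: BorelJacquet1979, §4.6] [cite: FleigEtAl2018, §12.3 Def. 12.5 (12.37) p. 296] -/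
theorem rightRegular_toLp_lineThetaLift [CompactSpace (adelicGroupData (↥(maximalRealSubfield L)) L (IsCMField.complexConj L) N H).automorphicQuotient] (ν : Measure (adelicGroupData (↥(maximalRealSubfield L)) L (IsCMField.complexConj L) N H).automorphicQuotient)
    [IsFiniteMeasure ν] [SMulInvariantMeasure (adelicGroupData (↥(maximalRealSubfield L)) L (IsCMField.complexConj L) N H).Adelic (adelicGroupData (↥(maximalRealSubfield L)) L (IsCMField.complexConj L) N H).automorphicQuotient ν] (k : (adelicGroupData (↥(maximalRealSubfield L)) L (IsCMField.complexConj L) N H).Adelic) :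
    (adelicGroupData (↥(maximalRealSubfield L)) L (IsCMField.complexConj L) N H).rightRegular ν k (MemLp.toLp _ (memLp_toQuotFun_lineThetaLift L N H e₁ dV hdV hdV0 ιA hιA μ hμ a hρ μW Φ f ν 2)) =
      MemLp.toLp _ (memLp_toQuotFun_lineThetaLift L N H e₁ dV hdV hdV0 ιA hιA μ hμ a hρ μW ((pairRep (↥(maximalRealSubfield L)) L (IsCMField.complexConj L) N 1 e₁ (Matrix.diagonal dV) (JW (↥(maximalRealSubfield L)) L a)
          (chiSplittingLine L e₁ dV hdV hdV0 (toHeckeCharacter L μ) (isUnitary_toHeckeCharacter L μ)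
            ((isOscillatorChar_toHeckeCharacter_iff μ).mpr hμ) (TW (↥(maximalRealSubfield L)) a)
            (isUnit_det_TW (↥(maximalRealSubfield L)) a) (JW (↥(maximalRealSubfield L)) L a) (JW_eq (↥(maximalRealSubfield L)) L a))) (ιA k, 1) Φ) f ν 2) := by
  haveI := compactSpace_quotient_range_toAdelic_JW L a
  rw [AdelicGroupData.rightRegular_apply, DomMulAct.mk_smul_toLp]
  refine MemLp.toLp_congr _ _ (Filter.Eventually.of_forall fun q => ?_)
  obtain ⟨x, rfl⟩ := QuotientGroup.mk_surjective q
  -- `k⁻¹ • [x] = [k⁻¹ x]` (`rfl`), then the closed formula on both sides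
  show toQuotFun (adelicGroupData (↥(maximalRealSubfield L)) L (IsCMField.complexConj L) N H) (fun y => (lineThetaKernelDatum L N e₁ dV hdV hdV0 μ hμ a hρ).thetaLiftFun μW Φ f (ιA y)) ((adelicGroupData (↥(maximalRealSubfield L)) L (IsCMField.complexConj L) N H).toAutomorphicQuotient (k⁻¹ * x)) =
    toQuotFun (adelicGroupData (↥(maximalRealSubfield L)) L (IsCMField.complexConj L) N H) (fun y => (lineThetaKernelDatum L N e₁ dV hdV hdV0 μ hμ a hρ).thetaLiftFun μW ((pairRep (↥(maximalRealSubfield L)) L (IsCMField.complexConj L) N 1 e₁ (Matrix.diagonal dV) (JW (↥(maximalRealSubfield L)) L a)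
          (chiSplittingLine L e₁ dV hdV hdV0 (toHeckeCharacter L μ) (isUnitary_toHeckeCharacter L μ)
            ((isOscillatorChar_toHeckeCharacter_iff μ).mpr hμ) (TW (↥(maximalRealSubfield L)) a)
            (isUnit_det_TW (↥(maximalRealSubfield L)) a) (JW (↥(maximalRealSubfield L)) L a) (JW_eq (↥(maximalRealSubfield L)) L a))) (ιA k, 1) Φ) f (ιA y)) ((adelicGroupData (↥(maximalRealSubfield L)) L (IsCMField.complexConj L) N H).toAutomorphicQuotient x)
  rw [toQuotFun_lineThetaLift_mk L N H e₁ dV hdV hdV0 ιA hιA μ hμ a hρ μW Φ f, toQuotFun_lineThetaLift_mk L N H e₁ dV hdV hdV0 ιA hιA μ hμ a hρ μW ((pairRep (↥(maximalRealSubfield L)) L (IsCMField.complexConj L) N 1 e₁ (Matrix.diagonal dV) (JW (↥(maximalRealSubfield L)) L a)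
          (chiSplittingLine L e₁ dV hdV hdV0 (toHeckeCharacter L μ) (isUnitary_toHeckeCharacter L μ)
            ((isOscillatorChar_toHeckeCharacter_iff μ).mpr hμ) (TW (↥(maximalRealSubfield L)) a)
            (isUnit_det_TW (↥(maximalRealSubfield L)) a) (JW (↥(maximalRealSubfield L)) L a) (JW_eq (↥(maximalRealSubfield L)) L a))) (ιA k, 1) Φ) f]
  have hmk : (QuotientGroup.mk (ιA (k⁻¹ * x)) : ↥(UnitaryGroup.adelic (↥(maximalRealSubfield L)) L (IsCMField.complexConj L) N (Matrix.diagonal dV)) ⧸ (UnitaryGroup.toAdelic (↥(maximalRealSubfield L)) L (IsCMField.complexConj L) N (Matrix.diagonal dV)).range) = (ιA k)⁻¹ • QuotientGroup.mk (ιA x) := by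
    rw [map_mul, map_inv]; rfl
  rw [hmk]
  exact ((lineThetaKernelDatum L N e₁ dV hdV hdV0 μ hμ a hρ).thetaLift_apply_smul μW Φ f _ _).trans (by rw [inv_inv]; rfl)

variable [SMulInvariantMeasure ↥(UnitaryGroup.adelic (↥(maximalRealSubfield L)) L (IsCMField.complexConj L) 1 (JW (↥(maximalRealSubfield L)) L a)) (↥(UnitaryGroup.adelic (↥(maximalRealSubfield L)) L (IsCMField.complexConj L) 1 (JW (↥(maximalRealSubfield L)) L a)) ⧸ (UnitaryGroup.toAdelic (↥(maximalRealSubfield L)) L (IsCMField.complexConj L) 1 (JW (↥(maximalRealSubfield L)) L a)).range) μW]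

/-- **`χ`-covariance in the Schwartz variable, on the group**: `Θ̃_{ω(1,h)Φ}(χ)(ιA x) = χ(h̄) · Θ̃_Φ(χ)(ιA x)` for every `h ∈ U(⟨a⟩)(𝔸_{L⁺})` and
every continuous unitary character `χ` of `[U(⟨a⟩)]` (★ `ThetaKernelDatum.thetaLift_act_right_charCM`, `μW` invariant).
[cite: FleigEtAl2018, §12.3 Def. 12.5 (12.37) p. 296] [cite: GelbartRogawski1991, §3.2 p. 457] -/
theorem lineThetaLiftFun_pairRep_one_charCM (h : ↥(UnitaryGroup.adelic (↥(maximalRealSubfield L)) L (IsCMField.complexConj L) 1 (JW (↥(maximalRealSubfield L)) L a))) :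
    haveI := normal_range_toAdelic_JW L a
    ∀ (χ : PontryaginDual (↥(UnitaryGroup.adelic (↥(maximalRealSubfield L)) L (IsCMField.complexConj L) 1 (JW (↥(maximalRealSubfield L)) L a)) ⧸ (UnitaryGroup.toAdelic (↥(maximalRealSubfield L)) L (IsCMField.complexConj L) 1 (JW (↥(maximalRealSubfield L)) L a)).range)) (x : (adelicGroupData (↥(maximalRealSubfield L)) L (IsCMField.complexConj L) N H).Adelic),
      (lineThetaKernelDatum L N e₁ dV hdV hdV0 μ hμ a hρ).thetaLiftFun μW ((pairRep (↥(maximalRealSubfield L)) L (IsCMField.complexConj L) N 1 e₁ (Matrix.diagonal dV) (JW (↥(maximalRealSubfield L)) L a)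
          (chiSplittingLine L e₁ dV hdV hdV0 (toHeckeCharacter L μ) (isUnitary_toHeckeCharacter L μ)
            ((isOscillatorChar_toHeckeCharacter_iff μ).mpr hμ) (TW (↥(maximalRealSubfield L)) a)
            (isUnit_det_TW (↥(maximalRealSubfield L)) a) (JW (↥(maximalRealSubfield L)) L a) (JW_eq (↥(maximalRealSubfield L)) L a))) (1, h) Φ) (charCM χ) (ιA x) =
        ((χ (QuotientGroup.mk h) : Circle) : ℂ) * (lineThetaKernelDatum L N e₁ dV hdV hdV0 μ hμ a hρ).thetaLiftFun μW Φ (charCM χ) (ιA x) := by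
  haveI := normal_range_toAdelic_JW L a
  intro χ x
  haveI : CompactSpace (↥(UnitaryGroup.adelic (↥(maximalRealSubfield L)) L (IsCMField.complexConj L) 1 (JW (↥(maximalRealSubfield L)) L a)) ⧸ (UnitaryGroup.toAdelic (↥(maximalRealSubfield L)) L (IsCMField.complexConj L) 1 (JW (↥(maximalRealSubfield L)) L a)).range) := compactSpace_quotient_range_toAdelic_JW L a
  rw [ThetaKernelDatum.thetaLiftFun_apply, ThetaKernelDatum.thetaLiftFun_apply]
  have key := (lineThetaKernelDatum L N e₁ dV hdV hdV0 μ hμ a hρ).thetaLift_act_right_charCM μW Φ h χ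
  rw [lineThetaKernelDatum_act_s] at key
  rw [key, ContinuousMap.smul_apply, smul_eq_mul]

/-- **`χ`-COVARIANCE OF THE CLASS**: `[Θ̃_{ω(1,h)Φ}(χ) ∘ ιA] = χ(h̄) • [Θ̃_Φ(χ) ∘ ιA]` in `L²([U(H)], ν)` — the linear map
`Φ ↦ [Θ̃_Φ(χ) ∘ ιA]` (theta-linear datum, `lineThetaKernelDatum_thetaLinear`) transforms under `1 × U(⟨a⟩)(𝔸)` through `χ`, i.e. it
factors through the `(U(⟨a⟩)(𝔸), χ)`-co-invariants of `ω` — Howe's big theta lift of the character, the shape ★ `Def411WeilCarriersAtLineCoinv`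
models at the finite places. [cite: FleigEtAl2018, §12.3 Def. 12.5 (12.37) p. 296] [cite: GelbartRogawski1991, §3.2 p. 457] -/
theorem toLp_lineThetaLift_pairRep_one_charCM [CompactSpace (adelicGroupData (↥(maximalRealSubfield L)) L (IsCMField.complexConj L) N H).automorphicQuotient] (ν : Measure (adelicGroupData (↥(maximalRealSubfield L)) L (IsCMField.complexConj L) N H).automorphicQuotient)
    [IsFiniteMeasure ν] (h : ↥(UnitaryGroup.adelic (↥(maximalRealSubfield L)) L (IsCMField.complexConj L) 1 (JW (↥(maximalRealSubfield L)) L a))) :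
    haveI := normal_range_toAdelic_JW L a
    ∀ χ : PontryaginDual (↥(UnitaryGroup.adelic (↥(maximalRealSubfield L)) L (IsCMField.complexConj L) 1 (JW (↥(maximalRealSubfield L)) L a)) ⧸ (UnitaryGroup.toAdelic (↥(maximalRealSubfield L)) L (IsCMField.complexConj L) 1 (JW (↥(maximalRealSubfield L)) L a)).range),
      MemLp.toLp _ (memLp_toQuotFun_lineThetaLift L N H e₁ dV hdV hdV0 ιA hιA μ hμ a hρ μW ((pairRep (↥(maximalRealSubfield L)) L (IsCMField.complexConj L) N 1 e₁ (Matrix.diagonal dV) (JW (↥(maximalRealSubfield L)) L a)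
          (chiSplittingLine L e₁ dV hdV hdV0 (toHeckeCharacter L μ) (isUnitary_toHeckeCharacter L μ)
            ((isOscillatorChar_toHeckeCharacter_iff μ).mpr hμ) (TW (↥(maximalRealSubfield L)) a)
            (isUnit_det_TW (↥(maximalRealSubfield L)) a) (JW (↥(maximalRealSubfield L)) L a) (JW_eq (↥(maximalRealSubfield L)) L a))) (1, h) Φ) (charCM χ) ν 2) =
        ((χ (QuotientGroup.mk h) : Circle) : ℂ) • MemLp.toLp _ (memLp_toQuotFun_lineThetaLift L N H e₁ dV hdV hdV0 ιA hιA μ hμ a hρ μW Φ (charCM χ) ν 2) := by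
  haveI := normal_range_toAdelic_JW L a
  intro χ
  rw [← MemLp.toLp_const_smul]
  refine MemLp.toLp_congr _ _ (Filter.Eventually.of_forall fun q => ?_)
  obtain ⟨x, rfl⟩ := QuotientGroup.mk_surjective q
  show toQuotFun (adelicGroupData (↥(maximalRealSubfield L)) L (IsCMField.complexConj L) N H) (fun y => (lineThetaKernelDatum L N e₁ dV hdV hdV0 μ hμ a hρ).thetaLiftFun μW ((pairRep (↥(maximalRealSubfield L)) L (IsCMField.complexConj L) N 1 e₁ (Matrix.diagonal dV) (JW (↥(maximalRealSubfield L)) L a)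
          (chiSplittingLine L e₁ dV hdV hdV0 (toHeckeCharacter L μ) (isUnitary_toHeckeCharacter L μ)
            ((isOscillatorChar_toHeckeCharacter_iff μ).mpr hμ) (TW (↥(maximalRealSubfield L)) a)
            (isUnit_det_TW (↥(maximalRealSubfield L)) a) (JW (↥(maximalRealSubfield L)) L a) (JW_eq (↥(maximalRealSubfield L)) L a))) (1, h) Φ) (charCM χ) (ιA y)) ((adelicGroupData (↥(maximalRealSubfield L)) L (IsCMField.complexConj L) N H).toAutomorphicQuotient x) =
    ((χ (QuotientGroup.mk h) : Circle) : ℂ) •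
      toQuotFun (adelicGroupData (↥(maximalRealSubfield L)) L (IsCMField.complexConj L) N H) (fun y => (lineThetaKernelDatum L N e₁ dV hdV hdV0 μ hμ a hρ).thetaLiftFun μW Φ (charCM χ) (ιA y)) ((adelicGroupData (↥(maximalRealSubfield L)) L (IsCMField.complexConj L) N H).toAutomorphicQuotient x)
  rw [toQuotFun_mk (fun γ hγ y => lineThetaLiftFun_transport_mul_left L N H e₁ dV hdV hdV0 ιA hιA μ hμ a hρ μW ((pairRep (↥(maximalRealSubfield L)) L (IsCMField.complexConj L) N 1 e₁ (Matrix.diagonal dV) (JW (↥(maximalRealSubfield L)) L a)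
          (chiSplittingLine L e₁ dV hdV hdV0 (toHeckeCharacter L μ) (isUnitary_toHeckeCharacter L μ)
            ((isOscillatorChar_toHeckeCharacter_iff μ).mpr hμ) (TW (↥(maximalRealSubfield L)) a)
            (isUnit_det_TW (↥(maximalRealSubfield L)) a) (JW (↥(maximalRealSubfield L)) L a) (JW_eq (↥(maximalRealSubfield L)) L a))) (1, h) Φ) (charCM χ) hγ y) x,
    toQuotFun_mk (fun γ hγ y => lineThetaLiftFun_transport_mul_left L N H e₁ dV hdV hdV0 ιA hιA μ hμ a hρ μW Φ (charCM χ) hγ y) x, smul_eq_mul]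
  exact lineThetaLiftFun_pairRep_one_charCM L N H e₁ dV hdV hdV0 ιA μ hμ a hρ μW Φ h χ x⁻¹

end Equivariance

end Summit.HodgeConjecture.HodgeConjecture.Cruxes.HLiu418.F0LD1ThetaTransportKit

end
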